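import Mathlib
import Summits.ValiantsHypothesis.ValiantsHypothesis.Theorems.BarrierLeverPartitionMinorsHitByVPSimplexJoinTwoDeepRank

/-!
# Route BarrierLever — item `PartitionMinorsHitByVP` (19717): two-slot obstruction with ASYMMETRIC levels `(m₁, m₂)`
Helper file (`--supports stmt-ValiantsHypothesis-19717`; cell valiant-natproofs, 𝒟-side door (c), line `hidden_states`, uniform-menu
lane; prover seat val-np-p3 gen 12). Definition-free; closes NO item. Completes `…SimplexJoinTwoDeep` (p627757) / `…TwoDeepRank`
(p629548), the case `m₁ = m₂`: a level-`m₁` relation on slot `f₁` and a level-`m₂` relation on slot `f₂` kill every row `U ⊆ A` with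
`|U| ≤ m₁+m₂+1` (`sum_sum_prod_eq_zero_levels`); with `x_f := |S p f|+1−Σ_{i≤m_f} C(|A|,i)`: `det_eq_zero_of_two_slots_levels`
(regime A: all rows small) and `det_eq_zero_of_two_slots_levels_rank` (more than `r − x₁x₂` small rows). Used by the case map of memo
val-np-p3 g12 §2(f) (levels `(2,0)`, `(1,0)`, `(2,1)`: pieces `V_wide × V_small`). Nothing on crux 14610 or VP ≠ VNP.
-/

set_option linter.dupNamespace false

namespace Summit.ValiantsHypothesis.ValiantsHypothesis.Theorems.BarrierLever.SimplexJoin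

open Finset Matrix

/-- **The tensor of a level-`m₁` and a level-`m₂` moment relation kills every row of size `≤ m₁ + m₂ + 1` inside `A`.** -/
theorem sum_sum_prod_eq_zero_levels {h m₁ m₂ : ℕ} (A : Finset (Fin h)) {α β : Type*} (L₁ : Finset α) (L₂ : Finset β)
    (Λ : α → ℂ) (Μ : β → ℂ) (x : α → Fin h → ℂ) (y : β → Fin h → ℂ) (c : Fin h → ℂ)
    (hl : ∀ W, W ⊆ A → W.card ≤ m₁ → ∑ o ∈ L₁, Λ o * ∏ a ∈ W, x o a = 0)
    (hm : ∀ W, W ⊆ A → W.card ≤ m₂ → ∑ o ∈ L₂, Μ o * ∏ a ∈ W, y o a = 0)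
    (U : Finset (Fin h)) (hUA : U ⊆ A) (hU : U.card ≤ m₁ + m₂ + 1) :
    ∑ o ∈ L₁, ∑ o' ∈ L₂, Λ o * Μ o' * ∏ a ∈ U, (c a + x o a + y o' a) = 0 := by
  -- expand in `y`: `∏ (y + (c + x)) = Σ_W (∏_W y) (∏_{U \ W} (c + x))`
  have hexp : ∀ o o', ∏ a ∈ U, (c a + x o a + y o' a) =
      ∑ W ∈ U.powerset, (∏ a ∈ W, y o' a) * ∏ a ∈ U \ W, (c a + x o a) := by
    intro o o'
    rw [← Finset.prod_add]
    exact Finset.prod_congr rfl fun a _ => by ring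
  have hinner : ∀ o, ∑ o' ∈ L₂, Μ o' * ∏ a ∈ U, (c a + x o a + y o' a) =
      ∑ W ∈ U.powerset, (∑ o' ∈ L₂, Μ o' * ∏ a ∈ W, y o' a) * ∏ a ∈ U \ W, (c a + x o a) := by
    intro o
    simp_rw [hexp, Finset.mul_sum]
    rw [Finset.sum_comm]
    refine Finset.sum_congr rfl fun W _ => ?_
    rw [Finset.sum_mul]
    exact Finset.sum_congr rfl fun o' _ => by ring
  calc ∑ o ∈ L₁, ∑ o' ∈ L₂, Λ o * Μ o' * ∏ a ∈ U, (c a + x o a + y o' a)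
      = ∑ o ∈ L₁, Λ o * ∑ o' ∈ L₂, Μ o' * ∏ a ∈ U, (c a + x o a + y o' a) := by
        refine Finset.sum_congr rfl fun o _ => ?_
        rw [Finset.mul_sum]
        exact Finset.sum_congr rfl fun o' _ => by ring
    _ = ∑ o ∈ L₁, Λ o * ∑ W ∈ U.powerset,
          (∑ o' ∈ L₂, Μ o' * ∏ a ∈ W, y o' a) * ∏ a ∈ U \ W, (c a + x o a) := by simp_rw [hinner]
    _ = ∑ W ∈ U.powerset, (∑ o' ∈ L₂, Μ o' * ∏ a ∈ W, y o' a) *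
          ∑ o ∈ L₁, Λ o * ∏ a ∈ U \ W, (c a + x o a) := by
        simp_rw [Finset.mul_sum]
        rw [Finset.sum_comm]
        refine Finset.sum_congr rfl fun W _ => Finset.sum_congr rfl fun o _ => by ring
    _ = 0 := by
        refine Finset.sum_eq_zero fun W hW => ?_
        have hWU : W ⊆ U := Finset.mem_powerset.mp hW
        by_cases hWc : W.card ≤ m₂
        · have hy0 : ∑ o' ∈ L₂, Μ o' * ∏ a ∈ W, y o' a = 0 := hm W (hWU.trans hUA) hWc
          rw [hy0, zero_mul]
        · have hrest : (U \ W).card ≤ m₁ := by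
            have := Finset.card_sdiff_add_card_eq_card hWU
            omega
          rw [sum_mul_prod_eq_zero_of_card_le_level A L₁ Λ x hl c (U \ W) (Finset.sdiff_subset.trans hUA) hrest,
            mul_zero]

/-- **TWO SLOTS AT LEVELS `(m₁, m₂)`, regime A.** If slot `f₁` offers at least `Σ_{i≤m₁} C(|A|,i)` options and slot `f₂` at least
`Σ_{i≤m₂} C(|A|,i)`, then for EVERY row family all of whose members lie in `A` with size `≤ m₁ + m₂ + 1`, and EVERY table, the
`u`-side matrix of the design is singular. -/
theorem det_eq_zero_of_two_slots_levels (h m₁ m₂ M D N r : ℕ) (A : Finset (Fin h)) (u : Fin r → Finset (Fin h))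
    (huA : ∀ i, u i ⊆ A) (hum : ∀ i, (u i).card ≤ m₁ + m₂ + 1)
    (S : Fin M → Fin D → Finset (Fin N))
    (e : Fin r → Fin M × (Fin D → Option (Fin N))) (he : Function.Injective e)
    (hlive : ∀ c : Fin M × (Fin D → Option (Fin N)),
      c ∈ Set.range e ↔ ∀ (f : Fin D) (j : Fin N), c.2 f = some j → j ∈ S c.1 f)
    (p : Fin M) (f₁ f₂ : Fin D) (hf : f₁ ≠ f₂)
    (hS₁ : ∑ i ∈ Finset.range (m₁ + 1), A.card.choose i ≤ (S p f₁).card)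
    (hS₂ : ∑ i ∈ Finset.range (m₂ + 1), A.card.choose i ≤ (S p f₂).card)
    (T : Fin M → Option (Fin D × Fin N) → Fin h → ℂ) :
    (Matrix.of fun i k : Fin r => ∏ a ∈ u i,
      (T (e k).1 none a + ∑ f : Fin D, ((e k).2 f).elim 0 fun j => T (e k).1 (some (f, j)) a)).det = 0 := by
  classical
  -- the two option families and their moment relations
  set L₁ : Finset (Option (Fin N)) := Finset.insertNone (S p f₁) with hL₁
  set L₂ : Finset (Option (Fin N)) := Finset.insertNone (S p f₂) with hL₂
  let x : Option (Fin N) → Fin h → ℂ := fun o a => o.elim 0 fun j => T p (some (f₁, j)) a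
  let y : Option (Fin N) → Fin h → ℂ := fun o a => o.elim 0 fun j => T p (some (f₂, j)) a
  have hc₁ : (A.powerset.filter (fun W => W.card ≤ m₁)).card < L₁.card := by
    rw [card_filter_powerset_card_le A m₁, hL₁, Finset.card_insertNone]; omega
  have hc₂ : (A.powerset.filter (fun W => W.card ≤ m₂)).card < L₂.card := by
    rw [card_filter_powerset_card_le A m₂, hL₂, Finset.card_insertNone]; omega
  obtain ⟨Λ, hl, o₁, ho₁, hΛ⟩ := momentRelation_of_card_lt h m₁ A L₁ x hc₁
  obtain ⟨Μ, hm, o₂, ho₂, hΜ⟩ := momentRelation_of_card_lt h m₂ A L₂ y hc₂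
  -- the sub-grid: patterns `g o o'` (slot f₁ ↦ o, slot f₂ ↦ o', other slots none)
  let pat : Option (Fin N) → Option (Fin N) → (Fin D → Option (Fin N)) :=
    fun o o' f => if f = f₁ then o else if f = f₂ then o' else none
  have hpat₁ : ∀ o o', pat o o' f₁ = o := fun o o' => by simp [pat]
  have hpat₂ : ∀ o o', pat o o' f₂ = o' := fun o o' => by simp [pat, hf.symm]
  have hpat₃ : ∀ o o' f, f ≠ f₁ → f ≠ f₂ → pat o o' f = none := fun o o' f h1 h2 => by simp [pat, h1, h2]
  have hlivepat : ∀ o ∈ L₁, ∀ o' ∈ L₂, (p, pat o o') ∈ Set.range e := by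
    intro o ho o' ho'
    rw [hlive]
    intro f j hfj
    change pat o o' f = some j at hfj
    change j ∈ S p f
    by_cases h1 : f = f₁
    · rw [h1, hpat₁] at hfj
      rw [h1]
      exact Finset.mem_insertNone.mp ho j (by rw [hfj]; rfl)
    · by_cases h2 : f = f₂
      · rw [h2, hpat₂] at hfj
        rw [h2]
        exact Finset.mem_insertNone.mp ho' j (by rw [hfj]; rfl)
      · rw [hpat₃ o o' f h1 h2] at hfj; exact absurd hfj (by simp)
  -- membership of a column in the sub-grid
  let InGrid : Fin r → Prop := fun k => (e k).1 = p ∧ ∀ f, f ≠ f₁ → f ≠ f₂ → (e k).2 f = none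
  have hgrid₁ : ∀ k, InGrid k → (e k).2 f₁ ∈ L₁ := by
    intro k hk; rw [hL₁, Finset.mem_insertNone]; intro j hj
    have := ((hlive (e k)).mp ⟨k, rfl⟩) f₁ j hj; rw [hk.1] at this; exact this
  have hgrid₂ : ∀ k, InGrid k → (e k).2 f₂ ∈ L₂ := by
    intro k hk; rw [hL₂, Finset.mem_insertNone]; intro j hj
    have := ((hlive (e k)).mp ⟨k, rfl⟩) f₂ j hj; rw [hk.1] at this; exact this
  have hgridpat : ∀ k, InGrid k → e k = (p, pat ((e k).2 f₁) ((e k).2 f₂)) := by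
    intro k hk
    refine Prod.ext hk.1 (funext fun f => ?_)
    change (e k).2 f = pat ((e k).2 f₁) ((e k).2 f₂) f
    by_cases h1 : f = f₁
    · rw [h1, hpat₁]
    · by_cases h2 : f = f₂
      · rw [h2, hpat₂]
      · rw [hpat₃ _ _ f h1 h2]; exact hk.2 f h1 h2
  -- the kernel vector
  let v : Fin r → ℂ := fun k => if InGrid k then Λ ((e k).2 f₁) * Μ ((e k).2 f₂) else 0
  -- the column of the pattern `(o, o')`
  have hkOf : ∀ oo : Option (Fin N) × Option (Fin N), oo ∈ L₁ ×ˢ L₂ → ∃ k, e k = (p, pat oo.1 oo.2) := by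
    intro oo hoo; obtain ⟨ho, ho'⟩ := Finset.mem_product.mp hoo
    exact hlivepat oo.1 ho oo.2 ho'
  let kOf : Option (Fin N) × Option (Fin N) → Fin r := fun oo =>
    if hoo : oo ∈ L₁ ×ˢ L₂ then (hkOf oo hoo).choose else ⟨0, by
      have : 0 < r := Fin.pos (hkOf (o₁, o₂) (Finset.mem_product.mpr ⟨ho₁, ho₂⟩)).choose
      exact this⟩
  have hkOf_spec : ∀ oo ∈ L₁ ×ˢ L₂, e (kOf oo) = (p, pat oo.1 oo.2) := by
    intro oo hoo; simp only [kOf, dif_pos hoo]; exact (hkOf oo hoo).choose_spec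
  have hkOf_grid : ∀ oo ∈ L₁ ×ˢ L₂, InGrid (kOf oo) := by
    intro oo hoo; refine ⟨by rw [hkOf_spec oo hoo], fun f h1 h2 => ?_⟩
    rw [hkOf_spec oo hoo]; exact hpat₃ _ _ f h1 h2
  have hv : v ≠ 0 := by
    intro hv
    have hoo : (o₁, o₂) ∈ L₁ ×ˢ L₂ := Finset.mem_product.mpr ⟨ho₁, ho₂⟩
    have h0 := congrFun hv (kOf (o₁, o₂))
    have h1 : v (kOf (o₁, o₂)) = Λ ((e (kOf (o₁, o₂))).2 f₁) * Μ ((e (kOf (o₁, o₂))).2 f₂) := if_pos (hkOf_grid _ hoo)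
    rw [h1, hkOf_spec _ hoo, Pi.zero_apply] at h0
    change Λ (pat o₁ o₂ f₁) * Μ (pat o₁ o₂ f₂) = 0 at h0
    rw [hpat₁, hpat₂] at h0
    exact (mul_eq_zero.mp h0).elim hΛ hΜ
  -- the point of a sub-grid column
  have hpoint : ∀ k, InGrid k → ∀ a, T (e k).1 none a + ∑ f : Fin D, ((e k).2 f).elim 0 (fun j => T (e k).1 (some (f, j)) a) =
      T p none a + x ((e k).2 f₁) a + y ((e k).2 f₂) a := by
    intro k hk a; rw [hk.1, Fintype.sum_eq_add f₁ f₂ hf]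
    · simp only [x, y, add_assoc]
    · intro f hff; rw [hk.2 f hff.1 hff.2]; rfl
  -- `M v = 0`
  apply (Matrix.exists_mulVec_eq_zero_iff).mp
  refine ⟨v, hv, funext fun i => ?_⟩
  simp only [Matrix.mulVec, dotProduct, Matrix.of_apply, Pi.zero_apply]
  calc ∑ k, (∏ a ∈ u i, (T (e k).1 none a + ∑ f : Fin D, ((e k).2 f).elim 0 fun j => T (e k).1 (some (f, j)) a)) * v k
      = ∑ k ∈ Finset.univ.filter InGrid, Λ ((e k).2 f₁) * Μ ((e k).2 f₂) *
          ∏ a ∈ u i, (T p none a + x ((e k).2 f₁) a + y ((e k).2 f₂) a) := by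
        rw [Finset.sum_filter]
        refine Finset.sum_congr rfl fun k _ => ?_
        by_cases hk : InGrid k
        · have hv' : v k = Λ ((e k).2 f₁) * Μ ((e k).2 f₂) := if_pos hk
          rw [if_pos hk, hv', Finset.prod_congr rfl fun a _ => hpoint k hk a]
          ring
        · have hv' : v k = 0 := if_neg hk
          rw [if_neg hk, hv', mul_zero]
    _ = ∑ oo ∈ L₁ ×ˢ L₂, Λ oo.1 * Μ oo.2 * ∏ a ∈ u i, (T p none a + x oo.1 a + y oo.2 a) := by
        refine Finset.sum_nbij' (fun k => ((e k).2 f₁, (e k).2 f₂)) kOf ?_ ?_ ?_ ?_ ?_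
        · intro k hk
          have hk' := (Finset.mem_filter.mp hk).2
          exact Finset.mem_product.mpr ⟨hgrid₁ k hk', hgrid₂ k hk'⟩
        · intro oo hoo
          exact Finset.mem_filter.mpr ⟨Finset.mem_univ _, hkOf_grid oo hoo⟩
        · intro k hk
          have hk' := (Finset.mem_filter.mp hk).2
          have hoo : ((e k).2 f₁, (e k).2 f₂) ∈ L₁ ×ˢ L₂ := Finset.mem_product.mpr ⟨hgrid₁ k hk', hgrid₂ k hk'⟩
          apply he
          rw [hkOf_spec _ hoo, ← hgridpat k hk']
        · intro oo hoo
          refine Prod.ext ?_ ?_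
          · show (e (kOf oo)).2 f₁ = oo.1
            rw [hkOf_spec oo hoo]; exact hpat₁ _ _
          · show (e (kOf oo)).2 f₂ = oo.2
            rw [hkOf_spec oo hoo]; exact hpat₂ _ _
        · intro k _; rfl
    _ = ∑ o ∈ L₁, ∑ o' ∈ L₂, Λ o * Μ o' * ∏ a ∈ u i, (T p none a + x o a + y o' a) := Finset.sum_product _ _ _
    _ = 0 := sum_sum_prod_eq_zero_levels A L₁ L₂ Λ Μ x y (fun a => T p none a) hl hm (u i) (huA i) (hum i)

/-- **TWO SLOTS AT LEVELS `(m₁, m₂)`, rank form.** With `x_f := |S p f| + 1 − Σ_{i ≤ m_f} C(|A|, i)`: if the row family has MORE THAN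
`r − x₁·x₂` members inside `A` of size `≤ m₁ + m₂ + 1`, then for EVERY table the `u`-side matrix of the design is singular. -/
theorem det_eq_zero_of_two_slots_levels_rank (h m₁ m₂ M D N r : ℕ) (A : Finset (Fin h)) (u : Fin r → Finset (Fin h))
    (S : Fin M → Fin D → Finset (Fin N))
    (e : Fin r → Fin M × (Fin D → Option (Fin N))) (he : Function.Injective e)
    (hlive : ∀ c : Fin M × (Fin D → Option (Fin N)),
      c ∈ Set.range e ↔ ∀ (f : Fin D) (j : Fin N), c.2 f = some j → j ∈ S c.1 f)
    (p : Fin M) (f₁ f₂ : Fin D) (hf : f₁ ≠ f₂)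
    (hrows : r < (Finset.univ.filter fun i => u i ⊆ A ∧ (u i).card ≤ m₁ + m₂ + 1).card +
      ((S p f₁).card + 1 - ∑ i ∈ Finset.range (m₁ + 1), A.card.choose i) *
      ((S p f₂).card + 1 - ∑ i ∈ Finset.range (m₂ + 1), A.card.choose i))
    (T : Fin M → Option (Fin D × Fin N) → Fin h → ℂ) :
    (Matrix.of fun i k : Fin r => ∏ a ∈ u i,
      (T (e k).1 none a + ∑ f : Fin D, ((e k).2 f).elim 0 fun j => T (e k).1 (some (f, j)) a)).det = 0 := by
  classical
  set Sm₁ := ∑ i ∈ Finset.range (m₁ + 1), A.card.choose i with hSmdef₁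
  set Sm₂ := ∑ i ∈ Finset.range (m₂ + 1), A.card.choose i with hSmdef₂
  set x₁ := (S p f₁).card + 1 - Sm₁ with hx₁
  set x₂ := (S p f₂).card + 1 - Sm₂ with hx₂
  set Small := Finset.univ.filter (fun i => u i ⊆ A ∧ (u i).card ≤ m₁ + m₂ + 1) with hSmall
  -- trivial case: no relations needed is impossible since r < |Small| + x₁x₂ and |Small| ≤ r
  have hSmall_le : Small.card ≤ r := (Finset.card_filter_le _ _).trans (by simp)
  have hx : 0 < x₁ * x₂ := by
    rcases Nat.eq_zero_or_pos (x₁ * x₂) with h0 | h0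
    · rw [h0] at hrows; omega
    · exact h0
  have hx₁ : 0 < x₁ := Nat.pos_of_ne_zero fun h' => by rw [h'] at hx; simp at hx
  have hx₂ : 0 < x₂ := Nat.pos_of_ne_zero fun h' => by rw [h'] at hx; simp at hx
  -- the two option families and their independent relations
  set L₁ : Finset (Option (Fin N)) := Finset.insertNone (S p f₁) with hL₁
  set L₂ : Finset (Option (Fin N)) := Finset.insertNone (S p f₂) with hL₂
  let x : Option (Fin N) → Fin h → ℂ := fun o a => o.elim 0 fun j => T p (some (f₁, j)) a
  let y : Option (Fin N) → Fin h → ℂ := fun o a => o.elim 0 fun j => T p (some (f₂, j)) a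
  have hn₁ : x₁ + (A.powerset.filter (fun W => W.card ≤ m₁)).card ≤ L₁.card := by
    rw [card_filter_powerset_card_le A m₁, hL₁, Finset.card_insertNone]; omega
  have hn₂ : x₂ + (A.powerset.filter (fun W => W.card ≤ m₂)).card ≤ L₂.card := by
    rw [card_filter_powerset_card_le A m₂, hL₂, Finset.card_insertNone]; omega
  obtain ⟨Λ, hl, hl0, hlI⟩ := exists_independent_relations h m₁ A L₁ x x₁ hn₁
  obtain ⟨Μ, hm, hm0, hmI⟩ := exists_independent_relations h m₂ A L₂ y x₂ hn₂
  -- the sub-grid (verbatim from `…TwoDeep`)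
  let pat : Option (Fin N) → Option (Fin N) → (Fin D → Option (Fin N)) :=
    fun o o' f => if f = f₁ then o else if f = f₂ then o' else none
  have hpat₁ : ∀ o o', pat o o' f₁ = o := fun o o' => by simp [pat]
  have hpat₂ : ∀ o o', pat o o' f₂ = o' := fun o o' => by simp [pat, hf.symm]
  have hpat₃ : ∀ o o' f, f ≠ f₁ → f ≠ f₂ → pat o o' f = none := fun o o' f h1 h2 => by simp [pat, h1, h2]
  have hlivepat : ∀ o ∈ L₁, ∀ o' ∈ L₂, (p, pat o o') ∈ Set.range e := by
    intro o ho o' ho'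
    rw [hlive]
    intro f j hfj
    change pat o o' f = some j at hfj
    change j ∈ S p f
    by_cases h1 : f = f₁
    · rw [h1, hpat₁] at hfj
      rw [h1]
      exact Finset.mem_insertNone.mp ho j (by rw [hfj]; rfl)
    · by_cases h2 : f = f₂
      · rw [h2, hpat₂] at hfj
        rw [h2]
        exact Finset.mem_insertNone.mp ho' j (by rw [hfj]; rfl)
      · rw [hpat₃ o o' f h1 h2] at hfj; exact absurd hfj (by simp)
  let InGrid : Fin r → Prop := fun k => (e k).1 = p ∧ ∀ f, f ≠ f₁ → f ≠ f₂ → (e k).2 f = none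
  have hgrid₁ : ∀ k, InGrid k → (e k).2 f₁ ∈ L₁ := by
    intro k hk; rw [hL₁, Finset.mem_insertNone]; intro j hj
    have := ((hlive (e k)).mp ⟨k, rfl⟩) f₁ j hj; rw [hk.1] at this; exact this
  have hgrid₂ : ∀ k, InGrid k → (e k).2 f₂ ∈ L₂ := by
    intro k hk; rw [hL₂, Finset.mem_insertNone]; intro j hj
    have := ((hlive (e k)).mp ⟨k, rfl⟩) f₂ j hj; rw [hk.1] at this; exact this
  have hgridpat : ∀ k, InGrid k → e k = (p, pat ((e k).2 f₁) ((e k).2 f₂)) := by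
    intro k hk
    refine Prod.ext hk.1 (funext fun f => ?_)
    change (e k).2 f = pat ((e k).2 f₁) ((e k).2 f₂) f
    by_cases h1 : f = f₁
    · rw [h1, hpat₁]
    · by_cases h2 : f = f₂
      · rw [h2, hpat₂]
      · rw [hpat₃ _ _ f h1 h2]; exact hk.2 f h1 h2
  have hkOf : ∀ oo : Option (Fin N) × Option (Fin N), oo ∈ L₁ ×ˢ L₂ → ∃ k, e k = (p, pat oo.1 oo.2) := by
    intro oo hoo; obtain ⟨ho, ho'⟩ := Finset.mem_product.mp hoo
    exact hlivepat oo.1 ho oo.2 ho'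
  have hne₁ : (none : Option (Fin N)) ∈ L₁ := by rw [hL₁]; exact Finset.none_mem_insertNone
  have hne₂ : (none : Option (Fin N)) ∈ L₂ := by rw [hL₂]; exact Finset.none_mem_insertNone
  let kOf : Option (Fin N) × Option (Fin N) → Fin r := fun oo =>
    if hoo : oo ∈ L₁ ×ˢ L₂ then (hkOf oo hoo).choose else ⟨0, by
      have : 0 < r := Fin.pos (hkOf (none, none) (Finset.mem_product.mpr ⟨hne₁, hne₂⟩)).choose
      exact this⟩
  have hkOf_spec : ∀ oo ∈ L₁ ×ˢ L₂, e (kOf oo) = (p, pat oo.1 oo.2) := by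
    intro oo hoo; simp only [kOf, dif_pos hoo]; exact (hkOf oo hoo).choose_spec
  have hkOf_grid : ∀ oo ∈ L₁ ×ˢ L₂, InGrid (kOf oo) := by
    intro oo hoo; refine ⟨by rw [hkOf_spec oo hoo], fun f h1 h2 => ?_⟩
    rw [hkOf_spec oo hoo]; exact hpat₃ _ _ f h1 h2
  have hpoint : ∀ k, InGrid k → ∀ a, T (e k).1 none a + ∑ f : Fin D, ((e k).2 f).elim 0 (fun j => T (e k).1 (some (f, j)) a) =
      T p none a + x ((e k).2 f₁) a + y ((e k).2 f₂) a := by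
    intro k hk a; rw [hk.1, Fintype.sum_eq_add f₁ f₂ hf]
    · simp only [x, y, add_assoc]
    · intro f hff; rw [hk.2 f hff.1 hff.2]; rfl
  -- the matrix and the kernel vectors `v st`
  set Mx : Matrix (Fin r) (Fin r) ℂ := Matrix.of fun i k : Fin r => ∏ a ∈ u i,
      (T (e k).1 none a + ∑ f : Fin D, ((e k).2 f).elim 0 fun j => T (e k).1 (some (f, j)) a) with hMx
  let v : Fin x₁ × Fin x₂ → Fin r → ℂ := fun st k =>
    if InGrid k then Λ st.1 ((e k).2 f₁) * Μ st.2 ((e k).2 f₂) else 0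
  -- (i) every small row kills every `v st`
  have hsmall : ∀ i, (u i ⊆ A ∧ (u i).card ≤ m₁ + m₂ + 1) → ∀ st, ∑ k, Mx i k * v st k = 0 := by
    intro i hi st
    calc ∑ k, Mx i k * v st k
        = ∑ k ∈ Finset.univ.filter InGrid, Λ st.1 ((e k).2 f₁) * Μ st.2 ((e k).2 f₂) *
            ∏ a ∈ u i, (T p none a + x ((e k).2 f₁) a + y ((e k).2 f₂) a) := by
          rw [Finset.sum_filter]
          refine Finset.sum_congr rfl fun k _ => ?_
          by_cases hk : InGrid k
          · have hv' : v st k = Λ st.1 ((e k).2 f₁) * Μ st.2 ((e k).2 f₂) := if_pos hk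
            rw [if_pos hk, hv', hMx, Matrix.of_apply, Finset.prod_congr rfl fun a _ => hpoint k hk a]
            ring
          · have hv' : v st k = 0 := if_neg hk
            rw [if_neg hk, hv', mul_zero]
      _ = ∑ oo ∈ L₁ ×ˢ L₂, Λ st.1 oo.1 * Μ st.2 oo.2 * ∏ a ∈ u i, (T p none a + x oo.1 a + y oo.2 a) := by
          refine Finset.sum_nbij' (fun k => ((e k).2 f₁, (e k).2 f₂)) kOf ?_ ?_ ?_ ?_ ?_
          · intro k hk
            have hk' := (Finset.mem_filter.mp hk).2
            exact Finset.mem_product.mpr ⟨hgrid₁ k hk', hgrid₂ k hk'⟩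
          · intro oo hoo
            exact Finset.mem_filter.mpr ⟨Finset.mem_univ _, hkOf_grid oo hoo⟩
          · intro k hk
            have hk' := (Finset.mem_filter.mp hk).2
            have hoo : ((e k).2 f₁, (e k).2 f₂) ∈ L₁ ×ˢ L₂ := Finset.mem_product.mpr ⟨hgrid₁ k hk', hgrid₂ k hk'⟩
            apply he
            rw [hkOf_spec _ hoo, ← hgridpat k hk']
          · intro oo hoo
            refine Prod.ext ?_ ?_
            · show (e (kOf oo)).2 f₁ = oo.1
              rw [hkOf_spec oo hoo]; exact hpat₁ _ _
            · show (e (kOf oo)).2 f₂ = oo.2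
              rw [hkOf_spec oo hoo]; exact hpat₂ _ _
          · intro k _; rfl
      _ = ∑ o ∈ L₁, ∑ o' ∈ L₂, Λ st.1 o * Μ st.2 o' * ∏ a ∈ u i, (T p none a + x o a + y o' a) :=
          Finset.sum_product _ _ _
      _ = 0 := sum_sum_prod_eq_zero_levels A L₁ L₂ (Λ st.1) (Μ st.2) x y (fun a => T p none a)
            (hl st.1) (hm st.2) (u i) hi.1 hi.2
  -- (ii) the `v st` are linearly independent
  have hvI : ∀ c : Fin x₁ × Fin x₂ → ℂ, (∑ st, c st • v st = 0) → c = 0 := by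
    intro c hc
    refine tensor_independent L₁ L₂ Λ Μ hlI hmI c fun o ho o' ho' => ?_
    have hoo : (o, o') ∈ L₁ ×ˢ L₂ := Finset.mem_product.mpr ⟨ho, ho'⟩
    have h1 := congrFun hc (kOf (o, o'))
    simp only [Finset.sum_apply, Pi.smul_apply, smul_eq_mul, Pi.zero_apply] at h1
    rw [← h1]
    refine Finset.sum_congr rfl fun st _ => ?_
    have hv' : v st (kOf (o, o')) = Λ st.1 ((e (kOf (o, o'))).2 f₁) * Μ st.2 ((e (kOf (o, o'))).2 f₂) :=
      if_pos (hkOf_grid _ hoo)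
    rw [hv', hkOf_spec _ hoo]
    change c st * (Λ st.1 o * Μ st.2 o') = c st * (Λ st.1 (pat o o' f₁) * Μ st.2 (pat o o' f₂))
    rw [hpat₁, hpat₂]
  -- (iii) the big rows are too few to separate them
  let Big := {i : Fin r // ¬ (u i ⊆ A ∧ (u i).card ≤ m₁ + m₂ + 1)}
  have hBig : Fintype.card Big < x₁ * x₂ := by
    have h1 : Fintype.card Big = r - Small.card := by
      rw [Fintype.card_subtype_compl, Fintype.card_fin]
      congr 1
      rw [hSmall, Fintype.card_subtype]
    rw [h1]; omega
  let Ψ : (Fin x₁ × Fin x₂ → ℂ) →ₗ[ℂ] (Big → ℂ) :=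
    { toFun := fun c i => ∑ st, c st * ∑ k, Mx i.1 k * v st k
      map_add' := by
        intro c c'; funext i; simp only [Pi.add_apply]; rw [← Finset.sum_add_distrib]
        exact Finset.sum_congr rfl fun st _ => by ring
      map_smul' := by
        intro a c; funext i; simp only [Pi.smul_apply, smul_eq_mul, RingHom.id_apply]; rw [Finset.mul_sum]
        exact Finset.sum_congr rfl fun st _ => by ring }
  have hΨ : LinearMap.ker Ψ ≠ ⊥ := by
    apply LinearMap.ker_ne_bot_of_finrank_lt
    rw [Module.finrank_fintype_fun_eq_card, Module.finrank_fintype_fun_eq_card, Fintype.card_prod, Fintype.card_fin,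
      Fintype.card_fin]
    exact hBig
  obtain ⟨c, hcker, hc0⟩ := (Submodule.ne_bot_iff _).mp hΨ
  -- the kernel vector of the whole matrix
  let w : Fin r → ℂ := fun k => ∑ st, c st * v st k
  have hw : w ≠ 0 := by
    intro hw
    apply hc0
    apply hvI c
    funext k
    simp only [Finset.sum_apply, Pi.smul_apply, smul_eq_mul, Pi.zero_apply]
    exact congrFun hw k
  apply (Matrix.exists_mulVec_eq_zero_iff).mp
  refine ⟨w, hw, funext fun i => ?_⟩
  simp only [Matrix.mulVec, dotProduct, Pi.zero_apply]
  have hrew : ∑ k, Mx i k * w k = ∑ st, c st * ∑ k, Mx i k * v st k := by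
    simp only [w, Finset.mul_sum]
    rw [Finset.sum_comm]
    exact Finset.sum_congr rfl fun st _ => Finset.sum_congr rfl fun k _ => by ring
  rw [hrew]
  by_cases hi : u i ⊆ A ∧ (u i).card ≤ m₁ + m₂ + 1
  · exact Finset.sum_eq_zero fun st _ => by rw [hsmall i hi st, mul_zero]
  · have := congrFun (LinearMap.mem_ker.mp hcker) ⟨i, hi⟩
    simpa [Ψ] using this

end Summit.ValiantsHypothesis.ValiantsHypothesis.Theorems.BarrierLever.SimplexJoin
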